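import Summits.BirchSwinnertonDyer.BirchSwinnertonDyer.Theorems.ManinLocalTwoThreeParamPoleJAlgebraic
import Literature.NumberTheory.EllipticCurves.KleinJIntegralQExpansion
import HarnessLib

/-!
# The integer-coefficient pole killer `Θ = (Δ^d·P(j))^e`

Cell `bsd-f2-manin`, prover seat p3 (gen 16), crux C3 `ManinPrimeToThreeAtNine` (stmt-22968): the
HOLOMORPHY input of the modular-form witness stub of line `kato_shift_three` v23
(`stub_kummerCubeRootModularFormWitness`, MEMO-an §80.12 step (6): `F = D′ρ⁻¹h·P(j)^e·Δ^k`).  With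
`…ParamPoleJAlgebraic` (`j` is algebraic at the poles of the modular parametrisation) the multiplier
`P(j)^e·Δ^k` can be taken with INTEGER `q`-expansion:

* `jPolyForm P d` (`P ∈ ℤ[X]`, `d : ℕ`) — the level-one modular form `∑_{i ≤ d} P_i·(E₄³)^i·Δ^{d−i}`
  of weight `12d`; for `deg P ≤ d` it is `Δ^d·P(j)` pointwise (`jPolyForm_apply`) and its
  `q`-expansion has integer coefficients (`exists_int_qExpansion_jPolyForm`; `E₄`, `Δ ∈ ℤ⟦q⟧`, tree
  `qExpansion_E₄`, `qExpansion_discriminant`).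
* `exists_int_levelOne_form_vanishing_at_poles` — **for `f ∈ S₂(Γ₀(N))` nonzero with rational
  coefficients, `Λ ⊇ Λ_f` with `g₂, g₃ ∈ ℚ`, and any `e`, there is a level-one modular form `Θ ≢ 0` of
  weight `12d` with `q`-expansion in `ℤ⟦q⟧` vanishing to order `≥ e` at EVERY pole of
  `x = ℘_Λ(2πi∫f)`** (`Θ = (Δ^d·P(j))^e`, `P = ∏_{s ∈ S}P_s` with `P_s ∈ ℤ[X] ∖ 0`, `P_s(j(s)) = 0` for a
  finite set `S` of poles meeting every `Γ₀(N)`-orbit of poles), and the same for a modular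
  parametrisation datum `D` of a curve over `ℚ` (`…_of_smul_eichlerIntegral_mem`).

Everything is proved; no named fact.  BSD is not proved by this; C2/C3 are not proved by this.
-/

set_option linter.dupNamespace false

noncomputable section

open Complex Filter Topology Set Function
open UpperHalfPlane hiding I
open scoped Real Topology Manifold MatrixGroups PeriodPair ModularForm
open ModularForm EisensteinSeries SlashInvariantForm ModularFormClass CongruenceSubgroup
open Literature.NumberTheory.EllipticCurves Literature.NumberTheory.EllipticCurves.ModularForms

namespace Summit.BirchSwinnertonDyer.BirchSwinnertonDyer.Theorems.ManinLocalTwoThree.ParamPoleJ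

/-! ### `Δ^d·P(j)` as a level-one modular form with integer `q`-expansion -/

/-- **`Δ^d·P(j)` as a level-one form of weight `12d`**: `∑_{i ≤ d} P_i • (E₄³)^i·Δ^{d−i}`
(`P ∈ ℤ[X]`; meaningful for `deg P ≤ d`). [folklore] -/
def jPolyForm (P : Polynomial ℤ) (d : ℕ) : ModularForm 𝒮ℒ (12 * (d : ℤ)) :=
  ∑ i : Fin (d + 1), ((P.coeff i : ℤ) : ℂ) •
    ((E₄cube.pow i).mul (delta.pow (d - i))).mcast (by have := i.is_lt; omega)

/-- Coercion of a finite sum of modular forms. [folklore] -/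
theorem coe_finset_sum {Γ : Subgroup (GL (Fin 2) ℝ)} {k : ℤ} {ι : Type*} (T : Finset ι)
    (F : ι → ModularForm Γ k) : (⇑(∑ i ∈ T, F i) : ℍ → ℂ) = ∑ i ∈ T, ⇑(F i) := by
  classical
  induction T using Finset.induction_on with
  | empty => simp
  | insert i T hi ih => rw [Finset.sum_insert hi, Finset.sum_insert hi, ModularForm.coe_add, ih]

/-- `q`-expansion of a finite sum of modular forms (period `1`, level one). [folklore] -/
theorem qExpansion_finset_sum {k : ℤ} {ι : Type*} (T : Finset ι) (F : ι → ModularForm 𝒮ℒ k) :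
    qExpansion 1 (⇑(∑ i ∈ T, F i)) = ∑ i ∈ T, qExpansion 1 (⇑(F i)) := by
  classical
  induction T using Finset.induction_on with
  | empty => simp [UpperHalfPlane.qExpansion_zero]
  | insert i T hi ih =>
    rw [Finset.sum_insert hi, Finset.sum_insert hi, ModularForm.coe_add,
      ModularForm.qExpansion_add one_pos one_mem_strictPeriods_SL, ih]

/-- **Pointwise**: `jPolyForm P d τ = Δ(τ)^d · P(j(τ))` for `deg P ≤ d` (`E₄³ = jΔ`). [folklore] -/
theorem jPolyForm_apply (P : Polynomial ℤ) {d : ℕ} (hd : P.natDegree ≤ d) (τ : ℍ) :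
    jPolyForm P d τ = ModularForm.discriminant τ ^ d * (P.map (Int.castRingHom ℂ)).eval (kleinJ τ) := by
  have hdeg : (P.map (Int.castRingHom ℂ)).natDegree < d + 1 :=
    (Polynomial.natDegree_map_le).trans_lt (Nat.lt_succ_of_le hd)
  rw [Polynomial.eval_eq_sum_range' hdeg, ← Fin.sum_univ_eq_sum_range, Finset.mul_sum, jPolyForm,
    coe_finset_sum, Finset.sum_apply]
  refine Finset.sum_congr rfl fun i _ ↦ ?_
  have hi : (i : ℕ) ≤ d := Nat.lt_succ_iff.mp i.is_lt
  rw [IsGLPos.smul_apply, smul_eq_mul, ModularForm.coe_mcast, ModularForm.coe_mul, Pi.mul_apply,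
    ModularForm.coe_pow, ModularForm.coe_pow, Pi.pow_apply, Pi.pow_apply, Polynomial.coeff_map]
  have hE : E₄cube τ = kleinJ τ * ModularForm.discriminant τ := by
    rw [E₄cube, ModularForm.coe_mcast, ModularForm.coe_pow, Pi.pow_apply, E₄_cube_eq_kleinJ_mul]
  have hΔ : delta τ = ModularForm.discriminant τ := rfl
  rw [hE, hΔ, mul_pow, show ModularForm.discriminant τ ^ d =
    ModularForm.discriminant τ ^ (i : ℕ) * ModularForm.discriminant τ ^ (d - i) by
      rw [← pow_add, Nat.add_sub_cancel' hi]]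
  simp only [eq_intCast]
  ring

/-- **Integer `q`-expansion**: `q-exp(jPolyForm P d) ∈ ℤ⟦q⟧` (as the image of an integer power
series). [folklore] -/
theorem exists_int_qExpansion_jPolyForm (P : Polynomial ℤ) (d : ℕ) :
    ∃ p : PowerSeries ℤ, qExpansion 1 (⇑(jPolyForm P d)) = p.map (Int.castRingHom ℂ) := by
  have hE : qExpansion 1 (⇑E₄cube) = (formalE4 ^ 3).map (Int.castRingHom ℂ) := by
    rw [E₄cube, ModularForm.qExpansion_mcast, ModularForm.qExpansion_pow one_pos one_mem_strictPeriods_SL,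
      qExpansion_E₄, map_pow]
  have hΔ : qExpansion 1 (⇑delta) = (PowerSeries.X * formalDeltaUnit).map (Int.castRingHom ℂ) :=
    qExpansion_discriminant
  refine ⟨∑ i : Fin (d + 1), ((P.coeff i : ℤ) : PowerSeries ℤ) *
    ((formalE4 ^ 3) ^ (i : ℕ) * (PowerSeries.X * formalDeltaUnit) ^ (d - i)), ?_⟩
  rw [jPolyForm, qExpansion_finset_sum, map_sum]
  refine Finset.sum_congr rfl fun i _ ↦ ?_
  rw [IsGLPos.coe_smul, ModularForm.qExpansion_smul one_pos one_mem_strictPeriods_SL,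
    ModularForm.qExpansion_mcast,
    ModularForm.qExpansion_mul one_pos one_mem_strictPeriods_SL,
    ModularForm.qExpansion_pow one_pos one_mem_strictPeriods_SL,
    ModularForm.qExpansion_pow one_pos one_mem_strictPeriods_SL, hE, hΔ]
  simp only [map_mul, map_pow, PowerSeries.map_X, PowerSeries.smul_eq_C_mul, map_intCast]

/-- `jPolyForm P d ∘ ofComplex` is analytic on the half-plane. [folklore] -/
theorem analyticAt_jPolyForm (P : Polynomial ℤ) (d : ℕ) {z : ℂ} (hz : 0 < z.im) :
    AnalyticAt ℂ (⇑(jPolyForm P d) ∘ ofComplex) z :=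
  (UpperHalfPlane.mdifferentiable_iff.mp (jPolyForm P d).holo').analyticOnNhd isOpen_upperHalfPlaneSet z hz

/-- **`jPolyForm P d` vanishes wherever `P(j) = 0`, to order `≥ 1`**. [folklore] -/
theorem one_le_analyticOrderAt_jPolyForm (P : Polynomial ℤ) {d : ℕ} (hd : P.natDegree ≤ d) {τ : ℍ}
    (hP : (P.map (Int.castRingHom ℂ)).eval (kleinJ τ) = 0) :
    1 ≤ analyticOrderAt (⇑(jPolyForm P d) ∘ ofComplex) (τ : ℂ) := by
  have h0 : (⇑(jPolyForm P d) ∘ ofComplex) (τ : ℂ) = 0 := by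
    rw [comp_apply, ofComplex_apply, jPolyForm_apply P hd, hP, mul_zero]
  exact Order.one_le_iff_ne_zero.mpr ((analyticAt_jPolyForm P d τ.im_pos).analyticOrderAt_ne_zero.mpr h0)

/-- **`jPolyForm P d ≢ 0`** for `P ≠ 0`, `deg P ≤ d` (`j` is surjective and `Δ ≠ 0`). [folklore] -/
theorem exists_jPolyForm_ne_zero {P : Polynomial ℤ} (hP : P ≠ 0) {d : ℕ} (hd : P.natDegree ≤ d) :
    ∃ τ : ℍ, jPolyForm P d τ ≠ 0 := by
  have hP' : P.map (Int.castRingHom ℂ) ≠ 0 :=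
    (Polynomial.map_ne_zero_iff (Int.castRingHom ℂ).injective_int).mpr hP
  have h := kleinJ_aeval_ne_zero hP'
  obtain ⟨τ, hτ⟩ : ∃ τ : ℍ, (P.map (Int.castRingHom ℂ)).eval (kleinJ τ) ≠ 0 := by
    by_contra! hall
    exact h (funext fun τ ↦ by simpa using hall τ)
  exact ⟨τ, by rw [jPolyForm_apply P hd]; exact mul_ne_zero (pow_ne_zero _ (discriminant_ne_zero τ)) hτ⟩

/-! ### The pole killer -/

variable {N : ℕ} [NeZero N]

/-- **An integer polynomial killed by `j` at every pole.**  For `f ≠ 0` rational, `Λ ⊇ Λ_f` with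
rational invariants: there is `P ∈ ℤ[X]`, `P ≠ 0`, with `P(j(τ₁)) = 0` at every pole `τ₁` of
`℘_Λ(2πi∫f)` (product over a finite set of orbit representatives of integer polynomials vanishing at the
algebraic numbers `j(s)`, `…ParamPoleJAlgebraic`). [cite: ShimuraIATAF1971, Thm. 7.14] -/
theorem exists_int_polynomial_aeval_kleinJ_eq_zero_of_pole (f : CuspForm (Gamma0 N) 2) (hf : f ≠ 0)
    (hrat : ∀ m, ∃ q : ℚ, (q : ℂ) = cuspCoeff f m) (L : PeriodPair)
    (hΛ : ∀ x ∈ periodLattice f, x ∈ L.lattice)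
    (hg₂ : ∃ q : ℚ, (q : ℂ) = L.g₂) (hg₃ : ∃ q : ℚ, (q : ℂ) = L.g₃) :
    ∃ P : Polynomial ℤ, P ≠ 0 ∧ ∀ τ : ℍ, eichlerIntegral f τ ∈ L.lattice →
      (P.map (Int.castRingHom ℂ)).eval (kleinJ τ) = 0 := by
  classical
  obtain ⟨S, hSP, hS⟩ := exists_finset_poles f hf L hΛ
  -- an integer polynomial for each representative
  have halg : ∀ s ∈ S, ∃ Q : Polynomial ℤ, Q ≠ 0 ∧ Polynomial.aeval (kleinJ s) Q = 0 := by
    intro s hs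
    have hint := isIntegral_kleinJ_of_eichlerIntegral_mem_lattice f hf hrat L hΛ hg₂ hg₃ (hSP s hs)
    exact (IsFractionRing.isAlgebraic_iff ℤ ℚ ℂ).mpr hint.isAlgebraic
  choose! Q hQ0 hQ using halg
  refine ⟨∏ s ∈ S, Q s, Finset.prod_ne_zero_iff.mpr fun s hs ↦ hQ0 s hs, fun τ hτ ↦ ?_⟩
  obtain ⟨γ, hγ, s, hs, rfl⟩ := hS τ hτ
  rw [kleinJ_smul, Polynomial.eval_map, ← algebraMap_int_eq, ← Polynomial.aeval_def, map_prod]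
  exact Finset.prod_eq_zero hs (hQ s hs)

/-- **The integer-coefficient pole killer.**  For `f ∈ S₂(Γ₀(N))`, `f ≠ 0`, with rational Fourier
coefficients, a lattice `Λ(L) ⊇ Λ_f` with `g₂(L), g₃(L) ∈ ℚ`, and any `e : ℕ`, there is a level-one
modular form `Θ` of weight `12d`, not identically zero, whose `q`-expansion has integer coefficients,
vanishing to analytic order `≥ e` at every pole `τ₁ ∈ ℍ` of `x = ℘_Λ(2πi∫f)` (`u(τ₁) ∈ Λ`).
`Θ = (Δ^{d₀}P(j))^e`.  [cite: ShimuraIATAF1971, §2.4 and Thm. 7.14] -/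
theorem exists_int_levelOne_form_vanishing_at_poles (f : CuspForm (Gamma0 N) 2) (hf : f ≠ 0)
    (hrat : ∀ m, ∃ q : ℚ, (q : ℂ) = cuspCoeff f m) (L : PeriodPair)
    (hΛ : ∀ x ∈ periodLattice f, x ∈ L.lattice)
    (hg₂ : ∃ q : ℚ, (q : ℂ) = L.g₂) (hg₃ : ∃ q : ℚ, (q : ℂ) = L.g₃) (e : ℕ) :
    ∃ (d : ℕ) (Θ : ModularForm 𝒮ℒ (12 * (d : ℤ))),
      (∃ τ : ℍ, Θ τ ≠ 0) ∧ (∃ p : PowerSeries ℤ, qExpansion 1 ⇑Θ = p.map (Int.castRingHom ℂ)) ∧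
      ∀ τ : ℍ, eichlerIntegral f τ ∈ L.lattice → (e : ℕ∞) ≤ analyticOrderAt (⇑Θ ∘ ofComplex) (τ : ℂ) := by
  obtain ⟨P, hP0, hP⟩ := exists_int_polynomial_aeval_kleinJ_eq_zero_of_pole f hf hrat L hΛ hg₂ hg₃
  refine ⟨e * P.natDegree, ((jPolyForm P P.natDegree).pow e).mcast (by push_cast; ring), ?_, ?_,
    fun τ hτ ↦ ?_⟩
  · obtain ⟨τ, hτ⟩ := exists_jPolyForm_ne_zero hP0 le_rfl
    exact ⟨τ, by rw [ModularForm.coe_mcast, ModularForm.coe_pow, Pi.pow_apply]; exact pow_ne_zero _ hτ⟩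
  · obtain ⟨p, hp⟩ := exists_int_qExpansion_jPolyForm P P.natDegree
    exact ⟨p ^ e, by rw [ModularForm.qExpansion_mcast,
      ModularForm.qExpansion_pow one_pos one_mem_strictPeriods_SL, hp, map_pow]⟩
  · have h1 := one_le_analyticOrderAt_jPolyForm P le_rfl (hP τ hτ)
    have han := analyticAt_jPolyForm P P.natDegree τ.im_pos
    rw [ModularForm.coe_mcast, ModularForm.coe_pow,
      show (⇑(jPolyForm P P.natDegree) ^ e) ∘ ofComplex = (⇑(jPolyForm P P.natDegree) ∘ ofComplex) ^ e
        from rfl, analyticOrderAt_pow han]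
    calc (e : ℕ∞) = e • (1 : ℕ∞) := by simp
      _ ≤ e • analyticOrderAt (⇑(jPolyForm P P.natDegree) ∘ ofComplex) (τ : ℂ) :=
          nsmul_le_nsmul_right h1 _

/-- **The pole killer for a modular parametrisation datum** `D` of a curve `W/ℚ` (`c ≠ 0`): a level-one
`Θ ≢ 0` with integer `q`-expansion vanishing to order `≥ e` at every `τ₁ ∈ ℍ` with `c·2πi∫f ∈ Λ_W`
(the points of `ℍ` over the origin `O` — where `W_u(c·E_f)`, `t_W`, `ρ⁻¹h` may have poles).
[cite: ShimuraIATAF1971, Thm. 7.14] -/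
theorem exists_int_levelOne_form_vanishing_of_smul_eichlerIntegral_mem {W : WeierstrassCurve ℚ}
    [W.IsElliptic] (D : ModularParametrizationData W N) (hc : D.c ≠ 0) (e : ℕ) :
    ∃ (d : ℕ) (Θ : ModularForm 𝒮ℒ (12 * (d : ℤ))),
      (∃ τ : ℍ, Θ τ ≠ 0) ∧ (∃ p : PowerSeries ℤ, qExpansion 1 ⇑Θ = p.map (Int.castRingHom ℂ)) ∧
      ∀ τ : ℍ, (D.c : ℂ) * eichlerIntegral D.f τ ∈ D.L.lattice →
        (e : ℕ∞) ≤ analyticOrderAt (⇑Θ ∘ ofComplex) (τ : ℂ) := by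
  have hc' : ((D.c : ℂ))⁻¹ ≠ 0 := inv_ne_zero (Int.cast_ne_zero.mpr hc)
  set L' : PeriodPair := D.L.mulLeft ((D.c : ℂ))⁻¹ hc' with hL'
  have hmem : ∀ x : ℂ, x ∈ L'.lattice ↔ (D.c : ℂ) * x ∈ D.L.lattice := fun x ↦ by
    rw [hL', PeriodPair.mem_mulLeft_lattice, inv_inv]
  have hΛ : ∀ x ∈ periodLattice D.f, x ∈ L'.lattice := fun x hx ↦
    (hmem x).mpr (D.smul_periodLattice_le x hx)
  have hf : D.f ≠ 0 := D.isNewformOf.1.ne_zero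
  have hrat : ∀ m, ∃ q : ℚ, (q : ℂ) = cuspCoeff D.f m := fun m ↦
    ⟨W.LFunction m, by rw [D.isNewformOf.2 m]; push_cast; rfl⟩
  have hg₂ : ∃ q : ℚ, (q : ℂ) = L'.g₂ := by
    refine ⟨(D.c : ℚ) ^ 4 * (W.c₄ / 12), ?_⟩
    rw [hL', PeriodPair.g₂_mulLeft, D.isNeronLattice.1, inv_pow, inv_inv, WeierstrassCurve.baseChange,
      WeierstrassCurve.map_c₄, eq_ratCast]
    push_cast
    ring
  have hg₃ : ∃ q : ℚ, (q : ℂ) = L'.g₃ := by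
    refine ⟨(D.c : ℚ) ^ 6 * (W.c₆ / 216), ?_⟩
    rw [hL', PeriodPair.g₃_mulLeft, D.isNeronLattice.2, inv_pow, inv_inv, WeierstrassCurve.baseChange,
      WeierstrassCurve.map_c₆, eq_ratCast]
    push_cast
    ring
  obtain ⟨d, Θ, h1, h2, h3⟩ :=
    exists_int_levelOne_form_vanishing_at_poles D.f hf hrat L' hΛ hg₂ hg₃ e
  exact ⟨d, Θ, h1, h2, fun τ hτ ↦ h3 τ ((hmem _).mpr hτ)⟩

end Summit.BirchSwinnertonDyer.BirchSwinnertonDyer.Theorems.ManinLocalTwoThree.ParamPoleJ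

end
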